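import Literature.Probability.LatticeModels.GhostTruncationBound
import Literature.Probability.LatticeModels.FieldCurrents
import Literature.Probability.LatticeModels.IsingEffectiveField
import Literature.Probability.LatticeModels.PlusFreeComparison
import HarnessLib

/-!
# `⟨σ_cσ_A⟩⁺ - ⟨σ_c⟩⁺⟨σ_A⟩⁺ ≤ ∑_{j∈A} ⟨σ_{A∖j}⟩⁺ ⟨σ_cσ_j⟩^free` for the finite-volume Ising model

Topic `Literature/Probability/LatticeModels`, namespace `Literature.Probability.LatticeModels`.
For the ferromagnetic nearest-neighbour Ising model in a finite volume `Λ` of a locally finite graph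
`G`, zero field, `β ≥ 0`, `c ∈ Λ`, `A ⊆ Λ`, `c ∉ A`:

  `⟨σ_{cA}⟩⁺_{Λ;β,0} - ⟨σ_c⟩⁺_{Λ;β,0} ⟨σ_A⟩⁺_{Λ;β,0} ≤ ∑_{j ∈ A} ⟨σ_{A∖j}⟩⁺_{Λ;β,0} · ⟨σ_cσ_j⟩^∅_{Λ;β,0}`

(`isingCorr_plus_insert_sub_mul_le_sum`). For `A = {j}` this is the GHS consequence
`⟨σ_c;σ_j⟩⁺ ≤ ⟨σ_cσ_j⟩^∅` of `GHSTruncatedPair.lean` (Dembo–Montanari; the input of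
Chelkak–Hongler–Izyurov's Lemma 2.26 for `k = 1`); the general form is the input of that lemma for
every `k` (`PlanarIsingBoundaryDecorrelation.lean`). It is the random-current inequality
`Current.ghost_truncation_bound_ratio` (`GhostTruncationBound.lean`) transported to the tree's Gibbs
states through **Griffiths' ghost vertex**: the `+` state of the volume `Λ` is the zero-field model on
the finite ghost graph over `Λ ∪ {g}` (`volGhostGraph`, the restriction of `ghostGraph G Λ` of
`FieldCurrents.lean` to the finite vertex type `Option ↥Λ`) with coupling `β` on the edges of `G` inside
`Λ` and `β · #{y ∉ Λ : y ∼ x}` on the ghost edge at `x` (`plusGhostCoupling`), read on the starred sets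
`A*` (`Current.gstar`); deleting the ghost edges gives the free state
(`isingCorr_plus_eq_wcurrentSum_div`, `isingCorr_free_eq_wcurrentSum_div`, through the dictionary
`sum_spinProduct_mul_prod_exp_eq` of `WeightedCurrentsDictionary.lean`). Everything is proved; no
named fact.

## References

* M. Aizenman, R. Fernández, J. Stat. Phys. 44 (1986) 393–454, Prop. 4.7, (4.22) [AizenmanFernandezJSP1986].
* R. B. Griffiths, J. Math. Phys. 8 (1967) 484 (ghost spin); S. Friedli, Y. Velenik, *Statistical
  Mechanics of Lattice Systems*, CUP 2017, §3.8.1 p. 141 (`K_{{i}} = β #{j ∉ Λ : j ∼ i}` for `+` b.c.)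
  [FriedliVelenik2017].
* D. Chelkak, C. Hongler, K. Izyurov, Ann. of Math. 181 (2015), §2.10, Lemma 2.26 [ChelkakHonglerIzyurovAnnals2015].
-/

noncomputable section

open Finset
open scoped symmDiff ENNReal

namespace Literature.Probability.LatticeModels

variable {V : Type*} [DecidableEq V] (G : SimpleGraph V) [DecidableRel G.Adj] (Λ : Finset V)

/-! ### The finite ghost graph over a volume -/

/-- The embedding `Λ ∪ {g} ↪ V ∪ {g}` of the finite vertex type `Option ↥Λ` into `Option V`. [folklore] -/
def volEmb : Option ↥Λ → Option V := Option.map Subtype.val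

variable {Λ} in
omit [DecidableEq V] in
/-- `volEmb` is injective. [folklore] -/
theorem volEmb_injective : Function.Injective (volEmb Λ) :=
  Option.map_injective Subtype.val_injective

omit [DecidableEq V] in
/-- `volEmb` at the ghost. [folklore] -/
@[simp] theorem volEmb_none : volEmb Λ none = none := rfl

omit [DecidableEq V] in
/-- `volEmb` at a real vertex. [folklore] -/
@[simp] theorem volEmb_some (x : ↥Λ) : volEmb Λ (some x) = some (x : V) := rfl

omit [DecidableEq V] in
/-- The range of `volEmb` lies in `Λ ∪ {g}`. [folklore] -/
theorem volEmb_mem_insertNone (a : Option ↥Λ) : volEmb Λ a ∈ Finset.insertNone Λ := by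
  cases a with
  | none => exact Finset.none_mem_insertNone
  | some x => exact Finset.some_mem_insertNone.2 x.2

variable {Λ} in
omit [DecidableEq V] in
/-- Every vertex of `Λ ∪ {g}` is in the range of `volEmb`. [folklore] -/
theorem exists_volEmb_eq {u : Option V} (hu : u ∈ Finset.insertNone Λ) : ∃ a, volEmb Λ a = u := by
  cases u with
  | none => exact ⟨none, rfl⟩
  | some x => exact ⟨some ⟨x, Finset.some_mem_insertNone.1 hu⟩, rfl⟩

/-- **The finite ghost graph over the volume `Λ`**: the graph `ghostGraph G Λ` of
`FieldCurrents.lean` (`G` plus a ghost joined to every vertex of `Λ`; Griffiths' ghost spin,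
Duminil-Copin–Tassion 2016, §2.3) restricted to the finite vertex type `Option ↥Λ` — the graph on which
the `+` state of `Λ` is a zero-field Ising model. [cite: DuminilCopinTassionCMP2016, §2.3 (the ghost vertex g) (arXiv:1502.03050 numbering)] -/
def volGhostGraph : SimpleGraph (Option ↥Λ) := (ghostGraph G Λ).comap (volEmb Λ)

/-- Adjacency in the finite ghost graph is decidable. [folklore] -/
instance volGhostGraph_decidableRel : DecidableRel (volGhostGraph G Λ).Adj := fun a b =>
  inferInstanceAs (Decidable ((ghostGraph G Λ).Adj (volEmb Λ a) (volEmb Λ b)))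

variable [G.LocallyFinite]

/-- The edges of the finite ghost graph, pushed to `Option V`, are the edges of the ghost graph inside
`Λ ∪ {g}`. [folklore] -/
theorem image_edgeFinset_volGhostGraph :
    (volGhostGraph G Λ).edgeFinset.image (Sym2.map (volEmb Λ)) =
      edgesIn (ghostGraph G Λ) (Finset.insertNone Λ) := by
  ext e'
  rw [Finset.mem_image, mem_edgesIn_iff]
  constructor
  · rintro ⟨e, he, rfl⟩
    induction e using Sym2.ind with
    | _ a b =>
      rw [SimpleGraph.mem_edgeFinset, SimpleGraph.mem_edgeSet] at he
      refine ⟨?_, ?_⟩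
      · rw [Sym2.map_mk, SimpleGraph.mem_edgeSet]; exact he
      · intro x hx
        rw [Sym2.map_mk, Sym2.mem_iff] at hx
        rcases hx with rfl | rfl <;> exact volEmb_mem_insertNone Λ _
  · rintro ⟨hadj, hmem⟩
    induction e' using Sym2.ind with
    | _ u v =>
      obtain ⟨a, rfl⟩ := exists_volEmb_eq (hmem u (Sym2.mem_mk_left u v))
      obtain ⟨b, rfl⟩ := exists_volEmb_eq (hmem _ (Sym2.mem_mk_right _ _))
      refine ⟨s(a, b), ?_, rfl⟩
      rw [SimpleGraph.mem_edgeFinset, SimpleGraph.mem_edgeSet]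
      exact (SimpleGraph.mem_edgeSet _).1 hadj

/-- **Sums over the edges of the finite ghost graph**: the edges of `G` inside `Λ` and the ghost edges
at `Λ`. [folklore] -/
theorem sum_edgeFinset_volGhostGraph {M : Type*} [AddCommMonoid M] (f : Sym2 (Option V) → M) :
    ∑ e ∈ (volGhostGraph G Λ).edgeFinset, f (Sym2.map (volEmb Λ) e) =
      ∑ e ∈ edgesIn G Λ, f (liftEdge e) + ∑ x ∈ Λ, f (ghostEdge x) := by
  rw [← sum_edgesIn_ghostGraph (subset_refl Λ), ← image_edgeFinset_volGhostGraph G Λ,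
    Finset.sum_image fun a _ b _ h => Sym2.map.injective volEmb_injective h]

/-! ### The couplings: `β` inside, `β · #{y ∉ Λ : y ∼ x}` on the ghost edge at `x` -/

/-- The number of neighbours of `x` outside `Λ`. [cite: FriedliVelenik2017, §3.8.1, p. 141] -/
def outDeg (x : V) : ℕ := #(outNbrs G Λ x)

/-- The `+`-boundary-condition couplings on the pairs of `V ∪ {g}`: `β` on a pair of real vertices,
`β · outDeg x` on `{x, g}` (Friedli–Velenik 2017, §3.8.1, p. 141: for the `+` boundary condition the
boundary bonds act as the fields `K_{{i}} = β #{j ∉ Λ : j ∼ i}`). [cite: FriedliVelenik2017, §3.8.1, p. 141] -/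
def plusGhostTheta (β : ℝ) : Sym2 (Option V) → ℝ :=
  Sym2.lift ⟨fun u v => match u, v with
      | some _, some _ => β
      | some x, none => β * outDeg G Λ x
      | none, some y => β * outDeg G Λ y
      | none, none => 0,
    by rintro (_ | x) (_ | y) <;> rfl⟩

variable {G Λ}

omit [DecidableRel G.Adj] in
/-- The coupling of a lifted edge is `β`. [folklore] -/
@[simp] theorem plusGhostTheta_liftEdge (β : ℝ) (e : Sym2 V) : plusGhostTheta G Λ β (liftEdge e) = β := by
  induction e using Sym2.ind with
  | _ x y => rfl

omit [DecidableRel G.Adj] in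
/-- The coupling of the ghost edge at `x` is `β · outDeg x`. [folklore] -/
@[simp] theorem plusGhostTheta_ghostEdge (β : ℝ) (x : V) :
    plusGhostTheta G Λ β (ghostEdge x) = β * outDeg G Λ x := rfl

omit [DecidableRel G.Adj] in
/-- The couplings are nonnegative for `β ≥ 0`. [folklore] -/
theorem plusGhostTheta_nonneg {β : ℝ} (hβ : 0 ≤ β) (e : Sym2 (Option V)) : 0 ≤ plusGhostTheta G Λ β e := by
  induction e using Sym2.ind with
  | _ u v =>
    rcases u with _ | x <;> rcases v with _ | y
    · exact le_rfl
    · exact mul_nonneg hβ (Nat.cast_nonneg _)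
    · exact mul_nonneg hβ (Nat.cast_nonneg _)
    · exact hβ

variable (G Λ)

/-- **The couplings of the finite ghost graph** realising the `+` state of `Λ` at inverse temperature
`β` and zero field. [cite: FriedliVelenik2017, §3.8.1, p. 141] -/
def plusGhostCoupling (β : ℝ) : (volGhostGraph G Λ).edgeFinset → ℝ := fun e =>
  plusGhostTheta G Λ β (Sym2.map (volEmb Λ) (e : Sym2 (Option ↥Λ)))

variable {G Λ}

/-- The couplings are nonnegative for `β ≥ 0`. [folklore] -/
theorem plusGhostCoupling_nonneg {β : ℝ} (hβ : 0 ≤ β) (e : (volGhostGraph G Λ).edgeFinset) :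
    0 ≤ plusGhostCoupling G Λ β e :=
  plusGhostTheta_nonneg hβ _

/-! ### Spin configurations with a ghost coordinate -/

/-- The configuration on `Λ ∪ {g}` with ghost spin `s` and volume spins `τ`. [folklore] -/
def ghostCfg (s : ℤˣ) (τ : ↥Λ → ℤˣ) : SpinConfig (Option ↥Λ) := fun a => a.elim s τ

/-- The configuration on `V ∪ {g}` with ghost spin `s` extending `σ`. [folklore] -/
def ghostLift (s : ℤˣ) (σ : SpinConfig V) : SpinConfig (Option V) := fun u => u.elim s σ

omit [DecidableEq V] [DecidableRel G.Adj] [G.LocallyFinite] in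
/-- Bond spins transport along maps of the vertex type. [folklore] -/
theorem bondSpin_map {W W' : Type*} (f : W → W') (σ : SpinConfig W') (e : Sym2 W) :
    bondSpin σ (Sym2.map f e) = bondSpin (σ ∘ f) e := by
  induction e using Sym2.ind with
  | _ x y => rfl

omit [DecidableEq V] [DecidableRel G.Adj] [G.LocallyFinite] in
/-- The lifted glued configuration restricted along `volEmb` is the ghost configuration. [folklore] -/
theorem ghostLift_glue_comp_volEmb (s : ℤˣ) (τ : ↥Λ → ℤˣ) (bc : BoundaryCondition V) :
    ghostLift s (glue Λ τ bc) ∘ volEmb Λ = ghostCfg s τ := by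
  funext a
  cases a with
  | none => rfl
  | some x =>
    simp only [Function.comp_apply, volEmb_some, ghostLift, ghostCfg, Option.elim]
    rw [glue_apply_of_mem Λ τ bc x.2]

omit [DecidableEq V] [DecidableRel G.Adj] [G.LocallyFinite] in
/-- Bond spin of a lifted edge. [folklore] -/
@[simp] theorem bondSpin_ghostLift_liftEdge (s : ℤˣ) (σ : SpinConfig V) (e : Sym2 V) :
    bondSpin (ghostLift s σ) (liftEdge e) = bondSpin σ e := by
  induction e using Sym2.ind with
  | _ x y => rfl

omit [DecidableEq V] [DecidableRel G.Adj] [G.LocallyFinite] in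
/-- Bond spin of a ghost edge: `σ_x · s`. [folklore] -/
@[simp] theorem bondSpin_ghostLift_ghostEdge (s : ℤˣ) (σ : SpinConfig V) (x : V) :
    bondSpin (ghostLift s σ) (ghostEdge x) = spinAt x σ * ((s : ℤ) : ℝ) := rfl

omit [DecidableEq V] in
/-- The spin at the ghost. [folklore] -/
@[simp] theorem spinAt_none_ghostCfg (s : ℤˣ) (τ : ↥Λ → ℤˣ) :
    spinAt (none : Option ↥Λ) (ghostCfg s τ) = ((s : ℤ) : ℝ) := rfl

omit [DecidableEq V] in
/-- The spin at a real vertex. [folklore] -/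
@[simp] theorem spinAt_some_ghostCfg (s : ℤˣ) (τ : ↥Λ → ℤˣ) (x : ↥Λ) :
    spinAt (some x) (ghostCfg s τ) = spinAt x τ := rfl

/-! ### Lifting source sets -/

variable (Λ) in
/-- The lift of a set of sites of `Λ` to the finite ghost vertex type. [folklore] -/
def liftVol (A : Finset V) : Finset (Option ↥Λ) := (A.subtype (· ∈ Λ)).map Function.Embedding.some

omit [DecidableRel G.Adj] [G.LocallyFinite] in
/-- Membership in `liftVol`. [folklore] -/
@[simp] theorem some_mem_liftVol {A : Finset V} {x : ↥Λ} : some x ∈ liftVol Λ A ↔ (x : V) ∈ A := by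
  simp [liftVol, Finset.mem_subtype]

omit [DecidableRel G.Adj] [G.LocallyFinite] in
/-- The ghost is not in a lifted set. [folklore] -/
@[simp] theorem none_notMem_liftVol (A : Finset V) : (none : Option ↥Λ) ∉ liftVol Λ A := by
  simp [liftVol]

omit [DecidableRel G.Adj] [G.LocallyFinite] in
/-- The cardinality of a lifted set of sites of `Λ`. [folklore] -/
theorem card_liftVol {A : Finset V} (hA : A ⊆ Λ) : #(liftVol Λ A) = #A := by
  rw [liftVol, card_map, ← Finset.card_map (Function.Embedding.subtype _), Finset.subtype_map,
    filter_true_of_mem fun x hx => hA hx]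

omit [DecidableRel G.Adj] [G.LocallyFinite] in
/-- `liftVol ∅ = ∅`. [folklore] -/
@[simp] theorem liftVol_empty : liftVol Λ (∅ : Finset V) = ∅ := by
  ext a; rcases a with _ | x <;> simp

omit [DecidableRel G.Adj] [G.LocallyFinite] in
/-- `liftVol` of an insertion. [folklore] -/
theorem liftVol_insert {A : Finset V} {c : V} (hc : c ∈ Λ) :
    liftVol Λ (insert c A) = insert (some ⟨c, hc⟩) (liftVol Λ A) := by
  ext a
  rcases a with _ | x
  · simp
  · simp only [some_mem_liftVol, mem_insert, Option.some.injEq]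
    constructor
    · rintro (h | h)
      · left; exact Subtype.ext h
      · right; exact h
    · rintro (h | h)
      · left; rw [h]
      · right; exact h

omit [DecidableRel G.Adj] [G.LocallyFinite] in
/-- `liftVol` of an erasure. [folklore] -/
theorem liftVol_erase (A : Finset V) (x : ↥Λ) : liftVol Λ (A.erase x) = (liftVol Λ A).erase (some x) := by
  ext a
  rcases a with _ | y
  · simp
  · simp only [some_mem_liftVol, mem_erase, Option.some.injEq, ne_eq]
    constructor
    · rintro ⟨h1, h2⟩; exact ⟨fun h => h1 (by rw [h]), h2⟩
    · rintro ⟨h1, h2⟩; exact ⟨fun h => h1 (Subtype.ext h), h2⟩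

omit [DecidableRel G.Adj] [G.LocallyFinite] in
/-- `liftVol {c} = {some c}`. [folklore] -/
theorem liftVol_singleton {c : V} (hc : c ∈ Λ) : liftVol Λ ({c} : Finset V) = {some ⟨c, hc⟩} := by
  rw [← insert_empty_eq c, liftVol_insert hc, liftVol_empty, insert_empty_eq]

omit [DecidableRel G.Adj] [G.LocallyFinite] in
/-- `liftVol {c, j} = {some c} ∆ {some j}` for `c ≠ j`. [folklore] -/
theorem liftVol_pair {c j : V} (hc : c ∈ Λ) (hj : j ∈ Λ) (hcj : c ≠ j) :
    liftVol Λ ({c, j} : Finset V) = ({some ⟨c, hc⟩} ∆ {some ⟨j, hj⟩} : Finset (Option ↥Λ)) := by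
  have hne : (some ⟨c, hc⟩ : Option ↥Λ) ≠ some ⟨j, hj⟩ := fun h => hcj (by
    have := Option.some_injective _ h; exact congrArg Subtype.val this)
  rw [liftVol_insert hc, liftVol_singleton hj, (disjoint_singleton.2 hne).symmDiff_eq_sup, sup_eq_union,
    ← insert_eq]

omit [DecidableRel G.Adj] [G.LocallyFinite] in
/-- The spin product of a lifted set under a ghost configuration is the glued spin product. [folklore] -/
theorem spinProduct_liftVol_ghostCfg {A : Finset V} (hA : A ⊆ Λ) (s : ℤˣ) (τ : ↥Λ → ℤˣ)
    (bc : BoundaryCondition V) :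
    spinProduct (liftVol Λ A) (ghostCfg s τ) = spinProduct A (glue Λ τ bc) := by
  unfold spinProduct liftVol
  rw [prod_map]
  simp only [Function.Embedding.some_apply, spinAt_some_ghostCfg]
  rw [← prod_subtype_of_mem (fun x => spinAt x (glue Λ τ bc)) hA]
  refine prod_congr rfl fun x _ => ?_
  rw [spinAt_glue_coe]

/-! ### The weights -/

omit [DecidableEq V] [DecidableRel G.Adj] [G.LocallyFinite] in
/-- The boundary spins of the `+` glued configuration are `+1`. [folklore] -/
theorem spinAt_glue_plus_of_notMem (τ : ↥Λ → ℤˣ) {z : V} (hz : z ∉ Λ) :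
    spinAt z (glue Λ τ .plus) = 1 := by
  rw [spinAt, glue_apply_of_notMem Λ τ _ hz]
  simp [BoundaryCondition.plus]

omit [DecidableRel G.Adj] in
/-- **The `+` Boltzmann weight through the ghost**: for the `+` boundary condition at zero field,
`w⁺(τ) = exp(β ∑_{e ∈ ℰ_Λ} σ_e + β ∑_{x ∈ Λ} outDeg(x) σ_x)` (Friedli–Velenik 2017, §3.8.1,
p. 141). [cite: FriedliVelenik2017, §3.8.1, p. 141] -/
theorem isingWeight_plus_zero_eq_exp (β : ℝ) (τ : ↥Λ → ℤˣ) :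
    isingWeight G Λ β 0 .plus τ =
      Real.exp (β * ∑ e ∈ edgesIn G Λ, bondSpin (glue Λ τ .plus) e +
        β * ∑ x ∈ Λ, (outDeg G Λ x : ℝ) * spinAt x (glue Λ τ .plus)) := by
  rw [isingWeight, isingHamiltonian]
  congr 1
  have hsplit : ∑ e ∈ interactionEdges G Λ BoundaryCondition.plus, bondSpin (glue Λ τ .plus) e =
      ∑ e ∈ edgeBoundary G Λ, bondSpin (glue Λ τ .plus) e + ∑ e ∈ edgesIn G Λ, bondSpin (glue Λ τ .plus) e := by
    rw [BoundaryCondition.plus, interactionEdges_fixed, edgeBoundary,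
      Finset.sum_sdiff (edgesIn_subset_edgesTouching (G := G) Λ)]
  have hbd : ∑ e ∈ edgeBoundary G Λ, bondSpin (glue Λ τ .plus) e =
      ∑ x ∈ Λ, (outDeg G Λ x : ℝ) * spinAt x (glue Λ τ .plus) := by
    rw [sum_edgeBoundary_bondSpin G Λ]
    refine sum_congr rfl fun x _ => ?_
    rw [mul_comm]
    congr 1
    rw [outDeg, Finset.card_eq_sum_ones, Nat.cast_sum]
    refine sum_congr rfl fun z hz => ?_
    rw [Nat.cast_one, spinAt_glue_plus_of_notMem τ ((mem_outNbrs G).1 hz).2]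
  rw [hsplit, hbd]
  ring

omit [DecidableRel G.Adj] in
/-- **The free Boltzmann weight** at zero field: `w^∅(τ) = exp(β ∑_{e ∈ ℰ_Λ} σ_e)`. [cite: FriedliVelenik2017, §3.1, eq. (3.2)] -/
theorem isingWeight_free_zero_eq_exp (β : ℝ) (τ : ↥Λ → ℤˣ) :
    isingWeight G Λ β 0 .free τ = Real.exp (β * ∑ e ∈ edgesIn G Λ, bondSpin (glue Λ τ .free) e) := by
  rw [isingWeight, isingHamiltonian, interactionEdges_free]
  congr 1
  ring

omit [DecidableRel G.Adj] in
/-- Bond spins of edges inside `Λ` do not see the boundary condition. [folklore] -/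
theorem bondSpin_glue_eq_of_mem_edgesIn (τ : ↥Λ → ℤˣ) (bc bc' : BoundaryCondition V) {e : Sym2 V}
    (he : e ∈ edgesIn G Λ) : bondSpin (glue Λ τ bc) e = bondSpin (glue Λ τ bc') e := by
  have hmem := (mem_edgesIn_iff.1 he).2
  induction e using Sym2.ind with
  | _ x y =>
    rw [bondSpin_mk, bondSpin_mk, spinAt, spinAt, spinAt, spinAt,
      glue_apply_of_mem Λ τ bc (hmem x (Sym2.mem_mk_left x y)),
      glue_apply_of_mem Λ τ bc' (hmem x (Sym2.mem_mk_left x y)),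
      glue_apply_of_mem Λ τ bc (hmem y (Sym2.mem_mk_right x y)),
      glue_apply_of_mem Λ τ bc' (hmem y (Sym2.mem_mk_right x y))]

omit [DecidableRel G.Adj] in
/-- Flipping all the spins of `Λ` does not change the bond spins inside `Λ`. [folklore] -/
theorem bondSpin_glue_neg_of_mem_edgesIn (τ : ↥Λ → ℤˣ) (bc : BoundaryCondition V) {e : Sym2 V}
    (he : e ∈ edgesIn G Λ) : bondSpin (glue Λ (-τ) bc) e = bondSpin (glue Λ τ bc) e := by
  have hmem := (mem_edgesIn_iff.1 he).2
  induction e using Sym2.ind with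
  | _ x y =>
    rw [bondSpin_mk, bondSpin_mk, spinAt, spinAt, spinAt, spinAt,
      glue_apply_of_mem Λ _ bc (hmem x (Sym2.mem_mk_left x y)),
      glue_apply_of_mem Λ τ bc (hmem x (Sym2.mem_mk_left x y)),
      glue_apply_of_mem Λ _ bc (hmem y (Sym2.mem_mk_right x y)),
      glue_apply_of_mem Λ τ bc (hmem y (Sym2.mem_mk_right x y))]
    simp [Units.val_neg]

/-- **The Boltzmann weight of the finite ghost graph** with ghost spin `s`:
`∏_e exp(K_e σ_e) = exp(β ∑_{ℰ_Λ} σ_e + s · β ∑_x outDeg(x) σ_x)`. [cite: FriedliVelenik2017, §3.8.1, p. 141] -/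
theorem prod_exp_plusGhostCoupling (β : ℝ) (s : ℤˣ) (τ : ↥Λ → ℤˣ) :
    ∏ e : (volGhostGraph G Λ).edgeFinset,
        Real.exp (plusGhostCoupling G Λ β e * bondSpin (ghostCfg s τ) (e : Sym2 (Option ↥Λ))) =
      Real.exp (β * ∑ e ∈ edgesIn G Λ, bondSpin (glue Λ τ .plus) e +
        ((s : ℤ) : ℝ) * (β * ∑ x ∈ Λ, (outDeg G Λ x : ℝ) * spinAt x (glue Λ τ .plus))) := by
  rw [← Real.exp_sum]
  congr 1
  set F : Sym2 (Option V) → ℝ := fun e' =>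
    plusGhostTheta G Λ β e' * bondSpin (ghostLift s (glue Λ τ .plus)) e' with hF
  have h1 : ∑ e : (volGhostGraph G Λ).edgeFinset,
      plusGhostCoupling G Λ β e * bondSpin (ghostCfg s τ) (e : Sym2 (Option ↥Λ)) =
      ∑ e ∈ (volGhostGraph G Λ).edgeFinset, F (Sym2.map (volEmb Λ) e) := by
    rw [← Finset.sum_coe_sort (volGhostGraph G Λ).edgeFinset]
    refine Finset.sum_congr rfl fun e _ => ?_
    simp only [hF, plusGhostCoupling, bondSpin_map, ghostLift_glue_comp_volEmb]
  rw [h1, sum_edgeFinset_volGhostGraph G Λ F]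
  simp only [hF, plusGhostTheta_liftEdge, plusGhostTheta_ghostEdge, bondSpin_ghostLift_liftEdge,
    bondSpin_ghostLift_ghostEdge]
  rw [Finset.mul_sum, Finset.mul_sum, Finset.mul_sum]
  congr 1
  refine Finset.sum_congr rfl fun x _ => ?_
  ring

omit [DecidableEq V] [DecidableRel G.Adj] [G.LocallyFinite] in
/-- `volEmb a = g` iff `a = g`. [folklore] -/
theorem volEmb_eq_none_iff {a : Option ↥Λ} : volEmb Λ a = none ↔ a = none := by
  cases a with
  | none => simp
  | some x => simp

omit [DecidableEq V] [DecidableRel G.Adj] [G.LocallyFinite] in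
/-- An edge of the finite ghost graph avoids the ghost iff its image avoids the ghost. [folklore] -/
theorem edgeOff_none_iff (e : Sym2 (Option ↥Λ)) :
    Current.EdgeOff ({none} : Finset (Option ↥Λ)) e ↔ (none : Option V) ∉ Sym2.map (volEmb Λ) e := by
  induction e using Sym2.ind with
  | _ a b =>
    rw [Current.edgeOff_mk, Sym2.map_mk, Sym2.mem_iff, not_or, mem_singleton, mem_singleton]
    constructor
    · rintro ⟨ha, hb⟩
      exact ⟨fun h => ha (volEmb_eq_none_iff.1 h.symm), fun h => hb (volEmb_eq_none_iff.1 h.symm)⟩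
    · rintro ⟨ha, hb⟩
      exact ⟨fun h => ha (by rw [h, volEmb_none]), fun h => hb (by rw [h, volEmb_none])⟩

/-- **The Boltzmann weight of the finite ghost graph with the ghost edges deleted** (free boundary
condition): `∏_e exp(K⁰_e σ_e) = exp(β ∑_{ℰ_Λ} σ_e)`, `K⁰ = cutCoupling K {g}`. [cite: FriedliVelenik2017, §3.1, eq. (3.2)] -/
theorem prod_exp_cutCoupling (β : ℝ) (s : ℤˣ) (τ : ↥Λ → ℤˣ) :
    ∏ e : (volGhostGraph G Λ).edgeFinset,
        Real.exp (cutCoupling (plusGhostCoupling G Λ β) {none} e * bondSpin (ghostCfg s τ) (e : Sym2 (Option ↥Λ))) =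
      Real.exp (β * ∑ e ∈ edgesIn G Λ, bondSpin (glue Λ τ .free) e) := by
  rw [← Real.exp_sum]
  congr 1
  set F : Sym2 (Option V) → ℝ := fun e' =>
    (if (none : Option V) ∉ e' then plusGhostTheta G Λ β e' else 0) *
      bondSpin (ghostLift s (glue Λ τ .free)) e' with hF
  have h1 : ∑ e : (volGhostGraph G Λ).edgeFinset,
      cutCoupling (plusGhostCoupling G Λ β) {none} e * bondSpin (ghostCfg s τ) (e : Sym2 (Option ↥Λ)) =
      ∑ e ∈ (volGhostGraph G Λ).edgeFinset, F (Sym2.map (volEmb Λ) e) := by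
    rw [← Finset.sum_coe_sort (volGhostGraph G Λ).edgeFinset]
    refine Finset.sum_congr rfl fun e _ => ?_
    simp only [hF, cutCoupling, plusGhostCoupling, bondSpin_map, ghostLift_glue_comp_volEmb]
    by_cases h : Current.EdgeOff ({none} : Finset (Option ↥Λ)) (e : Sym2 (Option ↥Λ))
    · rw [if_pos h, if_pos ((edgeOff_none_iff _).1 h)]
    · rw [if_neg h, if_neg (fun h' => h ((edgeOff_none_iff _).2 h'))]
  rw [h1, sum_edgeFinset_volGhostGraph G Λ F]
  simp only [hF, plusGhostTheta_liftEdge, bondSpin_ghostLift_liftEdge, if_pos (none_not_mem_liftEdge _),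
    if_neg (not_not.2 (none_mem_ghostEdge _)), zero_mul, sum_const_zero, add_zero, Finset.mul_sum]

omit [DecidableRel G.Adj] [G.LocallyFinite] in
/-- **Summing over the configurations of `Λ ∪ {g}`**: first the ghost spin, then the volume. [folklore] -/
theorem sum_spinConfig_option (F : SpinConfig (Option ↥Λ) → ℝ) :
    ∑ σ : SpinConfig (Option ↥Λ), F σ = ∑ s : ℤˣ, ∑ τ : ↥Λ → ℤˣ, F (ghostCfg s τ) := by
  rw [← Fintype.sum_prod_type']
  exact Fintype.sum_equiv (Equiv.piOptionEquivProd) _ _ fun σ => by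
    congr 1; funext a; cases a <;> rfl

omit [DecidableRel G.Adj] [G.LocallyFinite] in
/-- The spin product of a starred lifted set: `σ_{(A)*}(s, τ) = s^{[#A odd]} σ_A(τ)`. [folklore] -/
theorem spinProduct_gstar_liftVol_ghostCfg {A : Finset V} (hA : A ⊆ Λ) (s : ℤˣ) (τ : ↥Λ → ℤˣ)
    (bc : BoundaryCondition V) :
    spinProduct (Current.gstar none (liftVol Λ A)) (ghostCfg s τ) =
      (if Even #A then 1 else ((s : ℤ) : ℝ)) * spinProduct A (glue Λ τ bc) := by
  unfold Current.gstar
  rw [card_liftVol hA]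
  split_ifs with h
  · rw [one_mul, spinProduct_liftVol_ghostCfg hA]
  · rw [← spinProduct_mul_spinProduct, spinProduct_liftVol_ghostCfg hA s τ bc, mul_comm]
    congr 1
    simp [spinProduct]

/-- **The `+` Boltzmann sum as a spin sum of the finite ghost graph**:
`∑_σ σ_{A*} ∏_e exp(K_e σ_e) = 2 ∑_τ w⁺(τ) σ_A(τ)` (the configurations with ghost spin `-1` are the
flips of those with ghost spin `+1`; Griffiths' ghost spin). [cite: FriedliVelenik2017, §3.8.1, p. 141] -/
theorem sum_spinProduct_gstar_mul_prod_exp {A : Finset V} (hA : A ⊆ Λ) (β : ℝ) :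
    ∑ σ : SpinConfig (Option ↥Λ), spinProduct (Current.gstar none (liftVol Λ A)) σ *
        ∏ e : (volGhostGraph G Λ).edgeFinset,
          Real.exp (plusGhostCoupling G Λ β e * bondSpin σ (e : Sym2 (Option ↥Λ))) =
      2 * ∑ τ : ↥Λ → ℤˣ, isingWeight G Λ β 0 .plus τ * spinProduct A (glue Λ τ .plus) := by
  rw [sum_spinConfig_option]
  simp_rw [prod_exp_plusGhostCoupling, spinProduct_gstar_liftVol_ghostCfg hA _ _ .plus, isingWeight_plus_zero_eq_exp]
  rw [UnitsInt.univ, Finset.sum_pair (by decide)]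
  simp only [Units.val_one, Units.val_neg, Int.cast_one, Int.cast_neg, ite_self, one_mul, neg_mul, two_mul]
  congr 1
  · exact Fintype.sum_congr _ _ fun τ => by ring
  · rw [← Equiv.sum_comp (Equiv.neg (↥Λ → ℤˣ))]
    refine Fintype.sum_congr _ _ fun τ => ?_
    simp only [Equiv.neg_apply]
    rw [spinProduct_glue_neg_of_subset hA τ .plus,
      show ∑ e ∈ edgesIn G Λ, bondSpin (glue Λ (-τ) .plus) e = ∑ e ∈ edgesIn G Λ, bondSpin (glue Λ τ .plus) e from
        Finset.sum_congr rfl fun e he => bondSpin_glue_neg_of_mem_edgesIn τ .plus he,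
      show ∑ x ∈ Λ, (outDeg G Λ x : ℝ) * spinAt x (glue Λ (-τ) .plus) =
          -∑ x ∈ Λ, (outDeg G Λ x : ℝ) * spinAt x (glue Λ τ .plus) by
        rw [← Finset.sum_neg_distrib]
        exact Finset.sum_congr rfl fun x hx => by rw [spinAt_glue_neg_of_mem Λ τ .plus hx]; ring]
    have hsgn : (if Even #A then (1 : ℝ) else -1) * (-1) ^ #A = 1 := by
      split_ifs with h
      · rw [one_mul, h.neg_one_pow]
      · rw [Nat.not_even_iff_odd] at h; rw [h.neg_one_pow]; norm_num
    calc (if Even #A then (1 : ℝ) else -1) * ((-1) ^ #A * spinProduct A (glue Λ τ .plus)) *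
          Real.exp (β * ∑ e ∈ edgesIn G Λ, bondSpin (glue Λ τ .plus) e +
            -(β * -∑ x ∈ Λ, (outDeg G Λ x : ℝ) * spinAt x (glue Λ τ .plus)))
        = ((if Even #A then (1 : ℝ) else -1) * (-1) ^ #A) * (spinProduct A (glue Λ τ .plus) *
          Real.exp (β * ∑ e ∈ edgesIn G Λ, bondSpin (glue Λ τ .plus) e +
            β * ∑ x ∈ Λ, (outDeg G Λ x : ℝ) * spinAt x (glue Λ τ .plus))) := by
          rw [show -(β * -∑ x ∈ Λ, (outDeg G Λ x : ℝ) * spinAt x (glue Λ τ .plus)) =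
            β * ∑ x ∈ Λ, (outDeg G Λ x : ℝ) * spinAt x (glue Λ τ .plus) by ring]
          ring
      _ = Real.exp (β * ∑ e ∈ edgesIn G Λ, bondSpin (glue Λ τ .plus) e +
            β * ∑ x ∈ Λ, (outDeg G Λ x : ℝ) * spinAt x (glue Λ τ .plus)) * spinProduct A (glue Λ τ .plus) := by
          rw [hsgn, one_mul, mul_comm]

/-- **The free Boltzmann sum as a spin sum of the ghost-free graph**:
`∑_σ σ_{A} ∏_e exp(K⁰_e σ_e) = 2 ∑_τ w^∅(τ) σ_A(τ)`. [cite: FriedliVelenik2017, §3.1, eq. (3.2)] -/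
theorem sum_spinProduct_liftVol_mul_prod_exp_cut {A : Finset V} (hA : A ⊆ Λ) (β : ℝ) :
    ∑ σ : SpinConfig (Option ↥Λ), spinProduct (liftVol Λ A) σ *
        ∏ e : (volGhostGraph G Λ).edgeFinset,
          Real.exp (cutCoupling (plusGhostCoupling G Λ β) {none} e * bondSpin σ (e : Sym2 (Option ↥Λ))) =
      2 * ∑ τ : ↥Λ → ℤˣ, isingWeight G Λ β 0 .free τ * spinProduct A (glue Λ τ .free) := by
  rw [sum_spinConfig_option]
  simp_rw [prod_exp_cutCoupling, spinProduct_liftVol_ghostCfg hA _ _ .free, isingWeight_free_zero_eq_exp]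
  rw [UnitsInt.univ, Finset.sum_pair (by decide), ← two_mul]
  congr 1
  exact Fintype.sum_congr _ _ fun τ => by ring

/-! ### The dictionaries -/

omit [DecidableRel G.Adj] [G.LocallyFinite] in
/-- `(∅)* = ∅` on the finite ghost graph. [folklore] -/
theorem gstar_liftVol_empty : Current.gstar none (liftVol Λ (∅ : Finset V)) = ∅ := by
  rw [liftVol_empty]; rfl

/-- **The `+` state of `Λ` is the zero-field model on the finite ghost graph**:
`⟨σ_A⟩⁺_{Λ;β,0} = Z_K[A*]/Z_K[∅]`, `K` the `+` couplings (`β` inside, `β·outDeg` on the ghost edges),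
`A* = gstar g A` (Griffiths 1967; Friedli–Velenik 2017, §3.8.1; the random-current form through the
dictionary of `WeightedCurrentsDictionary.lean`). [cite: FriedliVelenik2017, §3.8.1, p. 141] -/
theorem isingCorr_plus_eq_wcurrentSum_div {β : ℝ} (hβ : 0 ≤ β) {A : Finset V} (hA : A ⊆ Λ) :
    isingCorr G Λ β 0 .plus A =
      wcurrentSum (plusGhostCoupling G Λ β) (Current.gstar none (liftVol Λ A)) /
        wcurrentSum (plusGhostCoupling G Λ β) ∅ := by
  have hK := plusGhostCoupling_nonneg (G := G) (Λ := Λ) hβ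
  have hN := sum_spinProduct_mul_prod_exp_eq hK (Current.gstar none (liftVol Λ A))
  have hZ := sum_spinProduct_mul_prod_exp_eq hK (Current.gstar none (liftVol Λ (∅ : Finset V)))
  rw [sum_spinProduct_gstar_mul_prod_exp hA] at hN
  rw [sum_spinProduct_gstar_mul_prod_exp (empty_subset Λ)] at hZ
  rw [gstar_liftVol_empty] at hZ
  simp only [spinProduct, prod_empty, mul_one] at hZ
  have hcorr : isingCorr G Λ β 0 .plus A =
      (∑ τ : ↥Λ → ℤˣ, isingWeight G Λ β 0 .plus τ * spinProduct A (glue Λ τ .plus)) /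
        ∑ τ : ↥Λ → ℤˣ, isingWeight G Λ β 0 .plus τ := by
    rw [isingCorr, isingExpect, integral_isingMeasure G Λ β 0 .plus (measurable_spinProduct A)]
    rfl
  rw [hcorr]
  have hZpos : 0 < ∑ τ : ↥Λ → ℤˣ, isingWeight G Λ β 0 .plus τ := isingPartitionFunction_pos G Λ β 0 .plus
  have hW0 : 0 < wcurrentSum (plusGhostCoupling G Λ β) ∅ := wcurrentSum_empty_pos hK
  rw [div_eq_div_iff hZpos.ne' hW0.ne']
  linear_combination (wcurrentSum (plusGhostCoupling G Λ β) ∅ / 2) * hN -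
    (wcurrentSum (plusGhostCoupling G Λ β) (Current.gstar none (liftVol Λ A)) / 2) * hZ

/-- **The free state of `Λ` is the zero-field model on the finite ghost graph with the ghost edges
deleted**: `⟨σ_A⟩^∅_{Λ;β,0} = Z_{K⁰}[A]/Z_{K⁰}[∅]`, `K⁰ = cutCoupling K {g}`. [cite: FriedliVelenik2017, §3.1, eq. (3.2)] -/
theorem isingCorr_free_eq_wcurrentSum_div {β : ℝ} (hβ : 0 ≤ β) {A : Finset V} (hA : A ⊆ Λ) :
    isingCorr G Λ β 0 .free A =
      wcurrentSum (cutCoupling (plusGhostCoupling G Λ β) {none}) (liftVol Λ A) /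
        wcurrentSum (cutCoupling (plusGhostCoupling G Λ β) {none}) ∅ := by
  have hK : ∀ e, 0 ≤ cutCoupling (plusGhostCoupling G Λ β) {none} e :=
    fun e => cutCoupling_nonneg (plusGhostCoupling_nonneg hβ) {none} e
  have hN := sum_spinProduct_mul_prod_exp_eq hK (liftVol Λ A)
  have hZ := sum_spinProduct_mul_prod_exp_eq hK (liftVol Λ (∅ : Finset V))
  rw [sum_spinProduct_liftVol_mul_prod_exp_cut hA] at hN
  rw [sum_spinProduct_liftVol_mul_prod_exp_cut (empty_subset Λ), liftVol_empty] at hZ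
  simp only [spinProduct, prod_empty, mul_one] at hZ
  have hcorr : isingCorr G Λ β 0 .free A =
      (∑ τ : ↥Λ → ℤˣ, isingWeight G Λ β 0 .free τ * spinProduct A (glue Λ τ .free)) /
        ∑ τ : ↥Λ → ℤˣ, isingWeight G Λ β 0 .free τ := by
    rw [isingCorr, isingExpect, integral_isingMeasure G Λ β 0 .free (measurable_spinProduct A)]
    rfl
  rw [hcorr]
  have hZpos : 0 < ∑ τ : ↥Λ → ℤˣ, isingWeight G Λ β 0 .free τ := isingPartitionFunction_pos G Λ β 0 .free
  have hW0 : 0 < wcurrentSum (cutCoupling (plusGhostCoupling G Λ β) {none}) ∅ := wcurrentSum_empty_pos hK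
  rw [div_eq_div_iff hZpos.ne' hW0.ne']
  linear_combination (wcurrentSum (cutCoupling (plusGhostCoupling G Λ β) {none}) ∅ / 2) * hN -
    (wcurrentSum (cutCoupling (plusGhostCoupling G Λ β) {none}) (liftVol Λ A) / 2) * hZ

/-! ### The truncation bound for the `+` state -/

omit [DecidableRel G.Adj] [G.LocallyFinite] in
/-- Sums over a lifted set of sites. [folklore] -/
theorem sum_liftVol {M : Type*} [AddCommMonoid M] (A : Finset V) (F : Option ↥Λ → M) :
    ∑ j ∈ liftVol Λ A, F j = ∑ x ∈ A.subtype (· ∈ Λ), F (some x) := by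
  unfold liftVol; rw [sum_map]; rfl

/-- **`⟨σ_cσ_A⟩⁺ - ⟨σ_c⟩⁺⟨σ_A⟩⁺ ≤ ∑_{j ∈ A} ⟨σ_{A∖j}⟩⁺ · ⟨σ_cσ_j⟩^free`** for the nearest-neighbour Ising
model in the finite volume `Λ` of a locally finite graph (`+` and free boundary conditions, zero field,
`β ≥ 0`, `c ∈ Λ ∖ A`, `A ⊆ Λ`): the random-current bound `Current.ghost_truncation_bound_ratio` read
through Griffiths' ghost (`isingCorr_plus_eq_wcurrentSum_div`, `isingCorr_free_eq_wcurrentSum_div`). For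
`A = {j}` it is the GHS consequence `⟨σ_c;σ_j⟩⁺ ≤ ⟨σ_cσ_j⟩^∅` (Aizenman–Fernández (4.22); the input of
Chelkak–Hongler–Izyurov's Lemma 2.26, `k = 1`); in general it is the input of that lemma for all `k`.
[cite: AizenmanFernandezJSP1986, §4.3, Proposition 4.7, eq. (4.22)] -/
theorem isingCorr_plus_insert_sub_mul_le_sum {β : ℝ} (hβ : 0 ≤ β) {A : Finset V} (hA : A ⊆ Λ)
    {c : V} (hc : c ∈ Λ) (hcA : c ∉ A) :
    isingCorr G Λ β 0 .plus (insert c A) - isingCorr G Λ β 0 .plus {c} * isingCorr G Λ β 0 .plus A ≤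
      ∑ j ∈ A, isingCorr G Λ β 0 .plus (A.erase j) * isingCorr G Λ β 0 .free {c, j} := by
  set K := plusGhostCoupling G Λ β with hKdef
  have hK : ∀ e, 0 ≤ K e := plusGhostCoupling_nonneg hβ
  have hK0 : ∀ e, 0 ≤ cutCoupling K {none} e := fun e => cutCoupling_nonneg hK {none} e
  set c' : Option ↥Λ := some ⟨c, hc⟩ with hc'
  have hc'A : c' ∉ liftVol Λ A := by simpa [hc'] using hcA
  have hcg : c' ≠ none := Option.some_ne_none _
  have h := Current.ghost_truncation_bound_ratio (G := volGhostGraph G Λ) (K := K) hK (g := none) hc'A hcg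
  simp only [toReal_ecurrentSum hK, ecurrentSumIn_offGraph_eq_cutCoupling, toReal_ecurrentSum hK0] at h
  rw [isingCorr_plus_eq_wcurrentSum_div hβ (insert_subset hc hA), liftVol_insert hc,
    isingCorr_plus_eq_wcurrentSum_div hβ (singleton_subset_iff.2 hc), liftVol_singleton hc,
    isingCorr_plus_eq_wcurrentSum_div hβ hA]
  have hgc : Current.gstar none ({c'} : Finset (Option ↥Λ)) = {c'} ∆ {none} := by
    unfold Current.gstar; rw [card_singleton]; exact if_neg (by decide)
  rw [hgc]
  refine le_trans h (le_of_eq ?_)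
  rw [sum_liftVol, ← sum_subtype_of_mem
    (fun j => isingCorr G Λ β 0 .plus (A.erase j) * isingCorr G Λ β 0 .free {c, j}) hA]
  refine sum_congr rfl fun x hx => ?_
  have hxA : (x : V) ∈ A := by simpa [Finset.mem_subtype] using hx
  have hcx : c ≠ x := fun h => hcA (h ▸ hxA)
  rw [isingCorr_plus_eq_wcurrentSum_div hβ ((erase_subset _ _).trans hA), liftVol_erase,
    isingCorr_free_eq_wcurrentSum_div hβ (insert_subset hc (singleton_subset_iff.2 x.2)),
    liftVol_pair hc x.2 hcx]

end Literature.Probability.LatticeModels
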